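import Literature.Topology.FourManifolds.OpenCollar
import Literature.Topology.FourManifolds.Morse
import Mathlib.Analysis.SpecialFunctions.SmoothTransition
import HarnessLib

/-!
# The collar-height function of an open collar: a smooth function on a manifold with boundary
# whose small sublevel sets are the collar slabs `∂M × [0, c]`, regular on the collar

Topic `Literature/Topology/FourManifolds`; companion of `TubeRadiusFunction.lean`, second brick of
the "regular domain" presentation of Kervaire–Milnor's `M₀ = M ∖ int φ(Sᵏ × Dᵏ⁺¹)` (M. Kervaire,
J. Milnor, *Groups of homotopy spheres I*, Ann. of Math. (2) 77 (1963), Lemma 5.6, p. 514) as a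
compact smooth manifold with boundary: the tree's regular sublevel sets
(`RegularSublevelSet.lean`, Milnor 1965 Lemma 2.9) must lie in the INTERIOR of the ambient
manifold, so `M₀ ⊇ ∂M` is first pushed off `∂M` along a collar — its boundary component `∂M`
becomes the collar level `∂M × {c}`, a diffeomorphic copy (Milnor, *Lectures on the h-cobordism
theorem* (1965), §1, after Thm. 1.4: "`W ∪ (∂W × I) ≅ W`"; the tree's `CollarShrink.lean`).

For an open collar `D` of a boundary datum `b` of `M` (`BoundaryData.OpenCollar`, `OpenCollar.lean`:
`D.toFun : ∂M × [0, ∞) → M` with inverse `(D.proj, D.height)` on the open `D.region`) this file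
constructs `D.collarHeightFn : M → ℝ`:

* `collarHeightFn (D.toFun x t) = ψ t` with `ψ = id` on `[0, ½]`, `ψ = 1` on `[¾, ∞)`, `ψ > ½` on
  `(½, ∞)` (`heightProfile`, from Mathlib's `Real.smoothTransition`), and `collarHeightFn = 1` off the
  collar;
* `contMDiff_collarHeightFn` — it is `C^∞` (`ψ ∘ height` on the open region; constant `1` off the
  compact slab `D.toFun(∂M × [0, 1])`);
* `collarHeightFn_le_iff`, `collarHeightFn_lt_iff`, `collarHeightFn_eq_iff` — for `0 < c ≤ ½` the
  sets `{collarHeightFn ≤ c}`, `{< c}`, `{= c}` are the slabs `D.toFun(∂M × [0, c])`, `[0, c)` and the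
  level `D.toFun(∂M × {c})`; `levelHomeomorph` — the level is homeomorphic to `∂M`;
* `not_isMCriticalPt_collarHeightFn` — no critical point on `D.toFun(∂M × (0, ½))` (the height is
  the identity along the collar lines `t ↦ D.toFun x t`, chain rule).

Everything is proved; the only definitions are the profile, the function and the level
homeomorphism.

## References

* M. Kervaire, J. Milnor, *Groups of homotopy spheres I*, Ann. of Math. (2) 77 (1963), Lemma 5.6
  (p. 514). doi:10.2307/1970128 [KervaireMilnorAnnals1963]
* J. Milnor, *Lectures on the h-cobordism theorem* (1965), §1 (collars), Lemma 2.9.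
  [MilnorHCobordism1965]
* T. Bröcker, K. Jänich, *Introduction to Differential Topology* (1982), (13.6). [BrockerJanich1982]
-/

noncomputable section

open scoped Manifold ContDiff Topology
open Set Function Metric

namespace Literature.Topology.FourManifolds

/-! ### The height profile -/

section Profile

/-- The smooth step `σ(t) = smoothTransition (4 (t - ½))`: `0` on `t ≤ ½`, `1` on `t ≥ ¾`. [folklore] -/
def heightStep (t : ℝ) : ℝ := Real.smoothTransition (4 * (t - 2⁻¹))

/-- **The height profile** `ψ(t) = (1 - σ t) t + σ t`: the identity on `(-∞, ½]`, `1` on `[¾, ∞)`,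
and `> ½` on `(½, ∞)`. [folklore] -/
def heightProfile (t : ℝ) : ℝ := (1 - heightStep t) * t + heightStep t

/-- The step is smooth. [folklore] -/
theorem contDiff_heightStep : ContDiff ℝ ∞ heightStep :=
  Real.smoothTransition.contDiff.comp (contDiff_const.mul (contDiff_id.sub contDiff_const))

/-- The profile is smooth. [folklore] -/
theorem contDiff_heightProfile : ContDiff ℝ ∞ heightProfile :=
  ((contDiff_const.sub contDiff_heightStep).mul contDiff_id).add contDiff_heightStep

/-- On `t ≤ ½` the step vanishes. [folklore] -/
theorem heightStep_of_le {t : ℝ} (ht : t ≤ 2⁻¹) : heightStep t = 0 :=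
  Real.smoothTransition.zero_of_nonpos (by linarith)

/-- On `t ≥ ¾` the step is `1`. [folklore] -/
theorem heightStep_of_ge {t : ℝ} (ht : 3 / 4 ≤ t) : heightStep t = 1 :=
  Real.smoothTransition.one_of_one_le (by linarith)

/-- On `t ≤ ½` the profile is `t`. [folklore] -/
theorem heightProfile_of_le {t : ℝ} (ht : t ≤ 2⁻¹) : heightProfile t = t := by
  simp [heightProfile, heightStep_of_le ht]

/-- On `t ≥ ¾` the profile is `1`. [folklore] -/
theorem heightProfile_of_ge {t : ℝ} (ht : 3 / 4 ≤ t) : heightProfile t = 1 := by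
  simp [heightProfile, heightStep_of_ge ht]

/-- On `t > ½` the profile exceeds `½` (it lies between `t` and `1`). [folklore] -/
theorem half_lt_heightProfile {t : ℝ} (ht : 2⁻¹ < t) : 2⁻¹ < heightProfile t := by
  have h0 : 0 ≤ heightStep t := Real.smoothTransition.nonneg _
  have h1 : heightStep t ≤ 1 := Real.smoothTransition.le_one _
  unfold heightProfile
  rcases le_or_gt t 1 with ht1 | ht1
  · -- `ψ = t + σ (1 - t) ≥ t`
    nlinarith [mul_nonneg h0 (sub_nonneg.2 ht1)]
  · -- `ψ = 1 + (1 - σ)(t - 1) ≥ 1`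
    nlinarith [mul_nonneg (sub_nonneg.2 h1) (sub_nonneg.2 ht1.le)]

/-- For `c ≤ ½`: `ψ t ≤ c ↔ t ≤ c`. [folklore] -/
theorem heightProfile_le_iff {c t : ℝ} (hc : c ≤ 2⁻¹) : heightProfile t ≤ c ↔ t ≤ c := by
  rcases le_or_gt t 2⁻¹ with ht | ht
  · rw [heightProfile_of_le ht]
  · constructor
    · intro h; exact absurd (hc.trans_lt (half_lt_heightProfile ht)) (not_lt.2 h)
    · intro h; exact absurd (h.trans hc) (not_le.2 ht)

/-- For `c ≤ ½`: `ψ t < c ↔ t < c`. [folklore] -/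
theorem heightProfile_lt_iff {c t : ℝ} (hc : c ≤ 2⁻¹) : heightProfile t < c ↔ t < c := by
  rcases le_or_gt t 2⁻¹ with ht | ht
  · rw [heightProfile_of_le ht]
  · constructor
    · intro h; exact absurd (hc.trans_lt (half_lt_heightProfile ht)) (not_lt.2 h.le)
    · intro h; exact absurd (h.le.trans hc) (not_le.2 ht)

/-- For `c ≤ ½`: `ψ t = c ↔ t = c`. [folklore] -/
theorem heightProfile_eq_iff {c t : ℝ} (hc : c ≤ 2⁻¹) : heightProfile t = c ↔ t = c := by
  rcases le_or_gt t 2⁻¹ with ht | ht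
  · rw [heightProfile_of_le ht]
  · constructor
    · intro h; exact absurd (hc.trans_lt (half_lt_heightProfile ht)) (by rw [h]; exact lt_irrefl c)
    · intro h; exact absurd (h.le.trans hc) (not_le.2 ht)

end Profile

/-! ### The collar-height function -/

namespace BoundaryData.OpenCollar

variable {n : ℕ} {M : Type} [TopologicalSpace M] [ChartedSpace (EuclideanHalfSpace (n + 1)) M]
  {b : BoundaryData (𝓡∂ (n + 1)) M (𝓡 n)} (D : b.OpenCollar)

/-- **The collar-height function** of an open collar: the height profile of the collar coordinate
on the collar, `1` off it. [cite: MilnorHCobordism1965, §1 after Thm. 1.4] -/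
def collarHeightFn (z : M) : ℝ := by
  classical
  exact if z ∈ D.region then heightProfile (D.height z) else 1

/-- On the collar the height function is the profile of the height. [folklore] -/
theorem collarHeightFn_apply (x : b.carrier) {t : ℝ} (ht : 0 ≤ t) :
    D.collarHeightFn (D.toFun x t) = heightProfile t := by
  classical
  unfold collarHeightFn
  rw [if_pos (D.mem_region x t ht), D.height_apply x t ht]

/-- On the region the height function is the profile of the height. [folklore] -/
theorem collarHeightFn_of_mem {z : M} (hz : z ∈ D.region) :
    D.collarHeightFn z = heightProfile (D.height z) := by
  classical
  unfold collarHeightFn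
  rw [if_pos hz]

/-- Off the collar the height function is `1`. [folklore] -/
theorem collarHeightFn_of_not_mem {z : M} (hz : z ∉ D.region) : D.collarHeightFn z = 1 := by
  classical
  unfold collarHeightFn
  rw [if_neg hz]

/-- **The sublevel sets below `½` are the collar slabs**: for `0 < c ≤ ½`, `collarHeightFn z ≤ c`
iff `z = D.toFun x t` with `0 ≤ t ≤ c`. [folklore] -/
theorem collarHeightFn_le_iff {c : ℝ} (hc : c ≤ 2⁻¹) (z : M) :
    D.collarHeightFn z ≤ c ↔ ∃ x t, t ∈ Icc 0 c ∧ D.toFun x t = z := by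
  constructor
  · intro h
    by_cases hz : z ∈ D.region
    · rw [D.collarHeightFn_of_mem hz, heightProfile_le_iff hc] at h
      exact ⟨D.proj z, D.height z, ⟨D.height_nonneg z hz, h⟩, D.apply_proj_height z hz⟩
    · rw [D.collarHeightFn_of_not_mem hz] at h
      exact absurd (h.trans hc) (by norm_num)
  · rintro ⟨x, t, ht, rfl⟩
    rw [D.collarHeightFn_apply x ht.1, heightProfile_le_iff hc]
    exact ht.2

/-- **The open slabs**: for `0 < c ≤ ½`, `collarHeightFn z < c` iff `z = D.toFun x t` with
`0 ≤ t < c`. [folklore] -/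
theorem collarHeightFn_lt_iff {c : ℝ} (hc : c ≤ 2⁻¹) (z : M) :
    D.collarHeightFn z < c ↔ ∃ x t, t ∈ Ico 0 c ∧ D.toFun x t = z := by
  constructor
  · intro h
    by_cases hz : z ∈ D.region
    · rw [D.collarHeightFn_of_mem hz, heightProfile_lt_iff hc] at h
      exact ⟨D.proj z, D.height z, ⟨D.height_nonneg z hz, h⟩, D.apply_proj_height z hz⟩
    · rw [D.collarHeightFn_of_not_mem hz] at h
      exact absurd (h.le.trans hc) (by norm_num)
  · rintro ⟨x, t, ht, rfl⟩
    rw [D.collarHeightFn_apply x ht.1, heightProfile_lt_iff hc]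
    exact ht.2

/-- **The collar levels**: for `0 < c ≤ ½`, `collarHeightFn z = c` iff `z = D.toFun x c`. [folklore] -/
theorem collarHeightFn_eq_iff {c : ℝ} (hc0 : 0 < c) (hc : c ≤ 2⁻¹) (z : M) :
    D.collarHeightFn z = c ↔ ∃ x, D.toFun x c = z := by
  constructor
  · intro h
    by_cases hz : z ∈ D.region
    · rw [D.collarHeightFn_of_mem hz, heightProfile_eq_iff hc] at h
      refine ⟨D.proj z, ?_⟩
      rw [← h]
      exact D.apply_proj_height z hz
    · rw [D.collarHeightFn_of_not_mem hz] at h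
      exact absurd (h.le.trans hc) (by norm_num)
  · rintro ⟨x, rfl⟩
    rw [D.collarHeightFn_apply x hc0.le, heightProfile_eq_iff hc]

/-- Above a level: `c < collarHeightFn z` iff `z` is not in the slab `D.toFun(∂M × [0, c])`
(`0 < c ≤ ½`). [folklore] -/
theorem lt_collarHeightFn_iff {c : ℝ} (hc : c ≤ 2⁻¹) (z : M) :
    c < D.collarHeightFn z ↔ ∀ x t, t ∈ Icc 0 c → D.toFun x t ≠ z := by
  rw [← not_le, D.collarHeightFn_le_iff hc]
  simp only [not_exists, not_and]

/-- **The collar level `{collarHeightFn = c}` is homeomorphic to `∂M`** (`0 < c ≤ ½`):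
`x ↦ D.toFun x c` with inverse `D.proj`. [cite: MilnorHCobordism1965, §1 after Thm. 1.4] -/
def levelHomeomorph {c : ℝ} (hc0 : 0 < c) (hc : c ≤ 2⁻¹) :
    b.carrier ≃ₜ {z : M // D.collarHeightFn z = c} where
  toFun x := ⟨D.toFun x c, (D.collarHeightFn_eq_iff hc0 hc _).2 ⟨x, rfl⟩⟩
  invFun z := D.proj z.1
  left_inv x := D.proj_apply x c hc0.le
  right_inv z := by
    obtain ⟨x, hx⟩ := (D.collarHeightFn_eq_iff hc0 hc z.1).1 z.2
    apply Subtype.ext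
    change D.toFun (D.proj z.1) c = z.1
    have hp : D.proj z.1 = x := by rw [← hx]; exact D.proj_apply x c hc0.le
    rw [hp, hx]
  continuous_toFun := by
    refine Continuous.subtype_mk ?_ _
    exact D.continuousOn_toFun.comp_continuous (continuous_id.prodMk continuous_const)
      fun x => ⟨mem_univ _, hc0.le⟩
  continuous_invFun := by
    refine D.continuousOn_proj.comp_continuous continuous_subtype_val fun z => ?_
    obtain ⟨x, hx⟩ := (D.collarHeightFn_eq_iff hc0 hc z.1).1 z.2
    rw [← hx]
    exact D.mem_region x c hc0.le

/-- The values of the level homeomorphism. [folklore] -/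
@[simp] theorem levelHomeomorph_apply_coe {c : ℝ} (hc0 : 0 < c) (hc : c ≤ 2⁻¹) (x : b.carrier) :
    ((D.levelHomeomorph hc0 hc x : {z : M // D.collarHeightFn z = c}) : M) = D.toFun x c := rfl

/-! ### Smoothness -/

/-- The slab `D.toFun(∂M × [0, 1])` is compact. [folklore] -/
theorem isCompact_slab_one [CompactSpace b.carrier] :
    IsCompact ((uncurry D.toFun) '' (univ ×ˢ Icc (0 : ℝ) 1)) :=
  (isCompact_univ.prod isCompact_Icc).image_of_continuousOn
    (D.continuousOn_toFun.mono (prod_mono_right Icc_subset_Ici_self))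

/-- Off the compact slab `D.toFun(∂M × [0, 1])` the height function is constantly `1`. [folklore] -/
theorem collarHeightFn_eq_one_of_not_mem_slab {z : M}
    (hz : z ∉ (uncurry D.toFun) '' (univ ×ˢ Icc (0 : ℝ) 1)) : D.collarHeightFn z = 1 := by
  by_cases hr : z ∈ D.region
  · rw [D.collarHeightFn_of_mem hr]
    refine heightProfile_of_ge ?_
    by_contra h1
    refine hz ⟨(D.proj z, D.height z), ⟨mem_univ _, D.height_nonneg z hr, by linarith [not_le.1 h1]⟩, ?_⟩
    exact D.apply_proj_height z hr
  · exact D.collarHeightFn_of_not_mem hr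

/-- **The collar-height function is smooth**: `ψ ∘ height` on the open collar region, constant
`1` off the compact slab `D.toFun(∂M × [0, 1])`; the two open sets cover. [folklore] -/
theorem contMDiff_collarHeightFn [T2Space M] [CompactSpace b.carrier] [IsManifold (𝓡∂ (n + 1)) ∞ M] :
    ContMDiff (𝓡∂ (n + 1)) 𝓘(ℝ, ℝ) ∞ D.collarHeightFn := by
  apply contMDiff_of_locally_contMDiffOn
  intro z
  by_cases hz : z ∈ (uncurry D.toFun) '' (univ ×ˢ Icc (0 : ℝ) 1)
  · refine ⟨D.region, D.isOpen_region, ?_, ?_⟩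
    · obtain ⟨⟨x, t⟩, ⟨-, ht⟩, rfl⟩ := hz
      exact D.mem_region x t ht.1
    · have h := contDiff_heightProfile.contMDiff.comp_contMDiffOn D.contMDiffOn_height
      exact h.congr fun y hy => D.collarHeightFn_of_mem hy
  · refine ⟨((uncurry D.toFun) '' (univ ×ˢ Icc (0 : ℝ) 1))ᶜ, D.isCompact_slab_one.isClosed.isOpen_compl,
      hz, ?_⟩
    exact (contMDiffOn_const (c := (1 : ℝ))).congr fun y hy => D.collarHeightFn_eq_one_of_not_mem_slab hy

/-- The collar-height function is continuous. [folklore] -/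
theorem continuous_collarHeightFn [T2Space M] [CompactSpace b.carrier] [IsManifold (𝓡∂ (n + 1)) ∞ M] :
    Continuous D.collarHeightFn := D.contMDiff_collarHeightFn.continuous

/-! ### Regularity on the collar -/

/-- **The height has non-zero derivative at every point of the collar of positive height**: along
the collar line `t ↦ D.toFun x t` it is the identity. [folklore] -/
theorem mfderiv_height_ne_zero [IsManifold (𝓡∂ (n + 1)) ∞ M] {z : M} (hz : z ∈ D.region)
    (h0 : 0 < D.height z) :
    mfderiv (𝓡∂ (n + 1)) 𝓘(ℝ, ℝ) D.height z ≠ 0 := by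
  intro hzero
  set x := D.proj z with hx
  set t₀ := D.height z with ht₀
  have hzt : D.toFun x t₀ = z := D.apply_proj_height z hz
  -- the collar line through `z` is smooth at `t₀ > 0`
  have hγ : ContMDiffAt 𝓘(ℝ, ℝ) (𝓡∂ (n + 1)) ∞ (fun t : ℝ => D.toFun x t) t₀ := by
    have hmem : univ ×ˢ Ici (0 : ℝ) ∈ 𝓝 (x, t₀) :=
      Filter.mem_of_superset ((isOpen_univ.prod isOpen_Ioi).mem_nhds ⟨mem_univ _, h0⟩)
        (prod_mono_right Ioi_subset_Ici_self)
    have h1 : ContMDiffAt ((𝓡 n).prod 𝓘(ℝ, ℝ)) (𝓡∂ (n + 1)) ∞ (uncurry D.toFun) (x, t₀) :=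
      D.contMDiffOn_toFun.contMDiffAt hmem
    exact h1.comp t₀ (contMDiffAt_const.prodMk contMDiffAt_id)
  have hγd : MDifferentiableAt 𝓘(ℝ, ℝ) (𝓡∂ (n + 1)) (fun t : ℝ => D.toFun x t) t₀ :=
    hγ.mdifferentiableAt (by simp)
  have hhd : MDifferentiableAt (𝓡∂ (n + 1)) 𝓘(ℝ, ℝ) D.height (D.toFun x t₀) := by
    rw [hzt]
    exact (D.contMDiffOn_height.contMDiffAt (D.isOpen_region.mem_nhds hz)).mdifferentiableAt (by simp)
  -- `height ∘ line = id` near `t₀`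
  have hev : (D.height ∘ fun t : ℝ => D.toFun x t) =ᶠ[𝓝 t₀] id := by
    filter_upwards [isOpen_Ioi.mem_nhds h0] with t ht
    exact D.height_apply x t (le_of_lt ht)
  have hcomp := mfderiv_comp t₀ hhd hγd
  rw [hzt] at hcomp
  rw [hzero, ContinuousLinearMap.zero_comp] at hcomp
  have hid : mfderiv 𝓘(ℝ, ℝ) 𝓘(ℝ, ℝ) (D.height ∘ fun t : ℝ => D.toFun x t) t₀ =
      ContinuousLinearMap.id ℝ ℝ := by
    rw [hev.mfderiv_eq]
    exact mfderiv_id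
  rw [hid] at hcomp
  have h1 := DFunLike.congr_fun hcomp (1 : ℝ)
  change (1 : ℝ) = 0 at h1
  exact one_ne_zero h1

/-- **The collar-height function has no critical point on `D.toFun(∂M × (0, ½))`**: there it agrees
with the height near the point. [cite: MilnorHCobordism1965, Lemma 2.9] -/
theorem not_isMCriticalPt_collarHeightFn [IsManifold (𝓡∂ (n + 1)) ∞ M] {z : M} (hz : z ∈ D.region)
    (h0 : 0 < D.height z) (h1 : D.height z < 2⁻¹) : ¬ IsMCriticalPt (𝓡∂ (n + 1)) D.collarHeightFn z := by
  intro hcrit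
  -- near `z` the height is `< ½`, so the function is the height itself
  have hO : IsOpen (D.region ∩ D.height ⁻¹' Iio 2⁻¹) :=
    D.continuousOn_height.isOpen_inter_preimage D.isOpen_region isOpen_Iio
  have hev : D.collarHeightFn =ᶠ[𝓝 z] D.height := by
    filter_upwards [hO.mem_nhds ⟨hz, h1⟩] with y hy
    rw [D.collarHeightFn_of_mem hy.1, heightProfile_of_le (le_of_lt hy.2)]
  have h : mfderiv (𝓡∂ (n + 1)) 𝓘(ℝ, ℝ) D.height z = 0 := by
    rw [← hev.mfderiv_eq]; exact hcrit
  exact D.mfderiv_height_ne_zero hz h0 h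

end BoundaryData.OpenCollar

end Literature.Topology.FourManifolds

end
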